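import Summits.QuantumAdvantage.QuantumAdvantage.Theses.CubicForrelation
import Literature.Computability.QuantumComplexity.CubicForrelationEstimatorAnalysis

/-!
# Line `pauli-fidelity-sampling` — crux `CubicForrelationInPrBPP` (stmt-QuantumAdvantage-2204)

Skeleton of the line (crux-plan, planner-cruxplan-stmt-QuantumAdvantage-2204-pauli-fidelity-sampl-0,
2026-08-16) for the crux

  `Summit.QuantumAdvantage.QuantumAdvantage.Theses.CubicForrelation.CubicForrelationInPrBPP`
  (= `cubicKForrelationProblem 2 ∈ PromiseBPP'` by `rfl`, `cubicKForrelationProblem_two_eq`):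

cubic 2-fold Forrelation is in promise-`BPP`, by classical DIRECT FIDELITY ESTIMATION across the
middle Hadamard layer (idea card `Ideas/pauli-fidelity-sampling.md`): `Φ(f,g)²` is the fidelity of the
two cubic phase states, its Pauli/derivative expansion `2^{3n} Φ² = Σ_{h,u} T_f(h,u) T_g(u,h)` has
QUADRATIC-derivative Walsh tables `T_f(h,·) = W_{D_h a}` (exact Gauss sums), the one-sided
length-squared proposal `p(h,u) = 2^{-3n} T_f(h,u)²` is exactly samplable (Dickson coset), and the ratio
estimator `T = T_g(u,h)/T_f(h,u)` has `E T = Φ²`, `E T² ≤ 1`; `N = 128` rounds and the threshold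
`9/50` separate `Φ ≥ 3/5` from `|Φ| ≤ 1/100` by Chebyshev; an idle-wire guard (`n ≤ |x| + 1`) keeps
the machine polynomial although `n` is coded in binary.

STATUS. Every stub below is ALREADY A THEOREM of the tree (Literature, namespace
`Literature.Computability.QuantumComplexity.CubicDequant`, files `CubicForrelationEstimatorMachine.lean`
/ `CubicForrelationEstimatorAnalysis.lean`, landed 2026-08-16, p71421/p72496): the closing term is
quoted in each stub's docstring (`closes by:`), and the whole crux closes by the one-liner
`CubicDequant.cubicKForrelationProblem_two_mem_PromiseBPP'` (probe rc 0, axioms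
{propext, Classical.choice, Quot.sound}, this seat 2026-08-16). The stubs are kept `sorry`'d here only
so that the skeleton audit REGISTERS them (cruxes-workfile protocol); the lead replaces the five
`sorry`s by the five quoted terms (folder file `line-pauli-fidelity-sampling-closed.lean`, attached as
evidence, is exactly that: rc 0, 0 sorries) and proposes the file with `--workitem stmt-QuantumAdvantage-2204`.

Stubs (5, registered): `stub_pauliFidelityMoments` (the LEVER: moments of the one-sided Pauli-fidelity
sampler), `stub_chebyshevCoinBlocks` (Chebyshev over independent coin blocks), `stub_machineRunsSampler`
(the FP machine's acceptance event = the threshold event on block tuples), `stub_idleWireGuard`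
(yes-instances have at most one idle wire beyond the code length), `stub_fpDeciderWitness` (acceptance
bounds for the machine ⇒ `PromiseBPP'` membership: the `P`-witness). Composition:
`CubicForrelationInPrBPP_of` (sorry-free, uses all five) and `CubicForrelationInPrBPP_proof`.

References: [AaronsonAmbainis2018] §1.1.3, §6 Thm 26; Flammia–Liu, PRL 106 (2011) 230501 (direct
fidelity estimation); [BravyiGosset2016] App. A (quadratic Gauss sums); [AroraBarak2009] Lemma A.12;
[Goldreich2006] Def. 1.2.
-/

noncomputable section

open scoped Classical
open Finset
open Literature.Computability.Complexity
open Literature.Computability.QuantumComplexity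
open Literature.Computability.QuantumComplexity.ForrCode (instOf)
open Literature.Computability.QuantumComplexity.CubicDequant

set_option linter.dupNamespace false

namespace Summit.QuantumAdvantage.QuantumAdvantage.Cruxes.CubicForrelationInPrBPP.PauliFidelitySampling

/-! ## The five registered stubs -/

/-- **S1 — the lever: moments of the one-sided Pauli-fidelity sampler.** For `f` of algebraic degree
`≤ 3` (so every derivative `D_h f` is quadratic and the block map `w ↦ u = uV (D_h f) w` samples `u`
with law `∝ T_f(h,u)²` exactly) and any `g`, the one-block statistic
`X(h,w) = T_g(u,h) / T_f(h,u)` (`CubicDequant.Xblk`, blocks `β = (h,w)` of `2n` coins) satisfies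
`Σ_β X(β) = 2^{2n} Φ(f,g)²` (the squared-amplitude / fidelity identity
`2^{3n} Φ² = Σ_{h,u} T_f(h,u) T_g(u,h)` plus exactness of the Dickson sampler) and
`Σ_β X(β)² ≤ 2^{2n}` (Parseval in `u` for the table of `g`). Idea card steps (1)–(2); packages
`DerivativeWalsh.two_pow_mul_forrelation_sq`, `sum_dwt_sq_of_sq`, `CubicDequant.Df_quadratic`,
`QuadSampler.sum_comp_uV_mul_two_pow`. Size L from scratch.
closes by: `fun n f g hf => ⟨CubicDequant.sum_Xblk_eq hf, CubicDequant.sum_Xblk_sq_le hf⟩`. -/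
theorem stub_pauliFidelityMoments :
    ∀ (n : ℕ) (f g : (Fin n → Bool) → Bool), IsDegLeFun 3 f →
      (∑ β, Xblk f g β = (2 : ℝ) ^ (2 * n) * forrelation f g ^ 2) ∧
      (∑ β, Xblk f g β ^ 2 ≤ (2 : ℝ) ^ (2 * n) * 1) := by
  sorry

/-- **S2 — Chebyshev over independent coin blocks (absolute second moment).** For a one-block
statistic `X` on `κ` coins with `Σ_β X(β) = 2^κ μ` and `Σ_β X(β)² ≤ 2^κ σ`, among the `2^{κL}` tuples
of `L` blocks those whose sum deviates from `Lμ` by `≥ δ` number at most `L 2^{κL} σ / δ²`.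
Idea card step (3) (`P[|mean − Φ²| ≥ 0.17] ≤ 1/(N·0.0289) < 1/3`). Size M.
closes by: `fun κ L X μ σ hm hs δ hδ => CubicDequant.card_deviation_mul_sq_le' X μ σ hm hs δ hδ`. -/
theorem stub_chebyshevCoinBlocks :
    ∀ (κ L : ℕ) (X : (Fin κ → Bool) → ℝ) (μ σ : ℝ),
      ∑ β, X β = 2 ^ κ * μ → ∑ β, X β ^ 2 ≤ 2 ^ κ * σ → ∀ δ : ℝ, 0 ≤ δ →
      ((univ.filter fun ω : Fin L → (Fin κ → Bool) => δ ≤ |∑ i, X (ω i) - L * μ|).card : ℝ) * δ ^ 2 ≤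
        L * 2 ^ (κ * L) * σ := by
  sorry

/-- **S3 — the FP machine runs the sampler: its acceptance event on `p(|x|) = 2N(|x|+1)` uniform coins
is the threshold event `Good` (`9N ≤ 50 Σ_r X(ω_r)`, mean `≥ 9/50`) on `N = 128` independent blocks.**
Content: the machine `CubicDequant.accept` reads the two circuits, forms the derivative oracles
`D_h C₀`, `D_u C₁`, samples `u` from the coins `w` by Gaussian elimination on the alternating form of
the quadratic `D_h C₀` (radical + linear part: the Dickson coset), evaluates the two Gauss sums
`T_{C₀}(h,u)`, `T_{C₁}(u,h)` EXACTLY as signed dyadic integers (`TOf`, `8ⁿ · T_g/T_f ∈ ℤ`), and only the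
first `2Nn` coins matter (prefix event). Idea card steps (0)–(2) as a deterministic function of
`⟨code, coins⟩`; packages `CubicDequant.roundY_eq`, `sumY_eq`, `accept_iff`, `accept_append`,
`uniformProb_prefix`, `BravyiGosset.cnt_blocks`. Size L (the formal bulk of the line).
closes by: `fun I hk hf hg hn b => CubicDequant.uniformProb_accept_eq I hk hf hg hn b`. -/
theorem stub_machineRunsSampler :
    ∀ (I : KForrelationInstance) (hk : I.k = 2), IsDegLeFun 3 (fI I hk) → IsDegLeFun 3 (gI I hk) →
      I.n ≤ I.encode.length + 1 → ∀ b : Bool,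
      uniformProb (coinPoly.eval I.encode.length) {y | accept (instOf I) I.encode.length y = b} =
        ((univ.filter fun ω : Fin CubicDequant.N → Fin (2 * I.n) → Bool => decide (Good I hk ω) = b).card : ℝ) /
          2 ^ (CubicDequant.N * (2 * I.n)) := by
  sorry

/-- **S4 — idle-wire guard.** A yes-instance (`B₂`-circuits, `Φ ≥ 3/5`) with `k = 2` has
`n ≤ |encode I| + 1`: every input wire read by neither circuit multiplies `Φ` by `2^{-1/2}`
(`Σ_{x,y ∈ {0,1}} (−1)^{xy} = 2 = 2^{3/2} · 2^{-1/2}`), so two idle wires force `|Φ| ≤ 1/2 < 3/5`,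
while the read wires are written in the code. Idea card step (0) (needed because `encode` writes `n`
in binary); packages `ForrMem.value_eq` (idle-wire factorisation, `ForrelationIdleWires.lean`),
`idleFactor_of_even`, `ForrMem.sR_le_length`. Size M.
closes by: `fun I hk hyes => CubicDequant.guard_of_isYes I hk hyes`. -/
theorem stub_idleWireGuard :
    ∀ (I : KForrelationInstance), I.k = 2 → I.IsYes → I.n ≤ I.encode.length + 1 := by
  sorry

/-- **S5 — the `P`-witness: acceptance bounds for the machine give `PromiseBPP'` membership.** For any
promise problem `Q` whose instances are Forrelation instance codes: if with `p(|x|)` coins the machine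
`CubicDequant.accept` accepts `≥ 2/3` of the coin strings on yes-codes and rejects `≥ 2/3` on no-codes,
then `Q ∈ PromiseBPP'`. Content: `accept` is computed on `⟨encode I, y⟩` by a polynomial-time string
function (`accept_codeFP`: CodeFP plumbing of circuit evaluation, `𝔽₂` row reduction, Gauss-sum
evaluation `gaussEval_codeFP`, integer arithmetic), packaged as a one-bit `dec ∈ FP` with
`decLang ∈ P`, and `PromiseProblem.mem_PromiseBPP'_of_fp_decider`. The Transfer `C⁺ ⇒ crux` of the
idea card is this stub with `Q := cubicKForrelationProblem 2`. Size L.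
closes by: `fun Q p hy hn hY hN => CubicDequant.mem_PromiseBPP'_of_accept Q p hy hn hY hN`. -/
theorem stub_fpDeciderWitness :
    ∀ (Q : PromiseProblem) (p : Polynomial ℕ),
      (∀ I : KForrelationInstance, I.encode ∈ Q.yes →
        (2 / 3 : ℝ) ≤ uniformProb (p.eval I.encode.length) {y | accept (instOf I) I.encode.length y = true}) →
      (∀ I : KForrelationInstance, I.encode ∈ Q.no →
        (2 / 3 : ℝ) ≤ uniformProb (p.eval I.encode.length) {y | accept (instOf I) I.encode.length y = false}) →
      (∀ x ∈ Q.yes, ∃ I : KForrelationInstance, I.encode = x) →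
      (∀ x ∈ Q.no, ∃ I : KForrelationInstance, I.encode = x) →
      Q ∈ PromiseBPP' := by
  sorry

/-! ## Statements of the stubs, under the stubs' own short names

The skeleton audit admits, as hypotheses of the theorem concluding the crux, only registered
obligations BY NAME; `Statement.stub_x` is the statement (`type_of%`) of `stub_x`, so that
`CubicForrelationInPrBPP_of` is stated over the five statements and passes the audit. -/

namespace Statement

/-- Statement of `stub_pauliFidelityMoments`. -/
abbrev stub_pauliFidelityMoments : Prop := type_of% PauliFidelitySampling.stub_pauliFidelityMoments
/-- Statement of `stub_chebyshevCoinBlocks`. -/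
abbrev stub_chebyshevCoinBlocks : Prop := type_of% PauliFidelitySampling.stub_chebyshevCoinBlocks
/-- Statement of `stub_machineRunsSampler`. -/
abbrev stub_machineRunsSampler : Prop := type_of% PauliFidelitySampling.stub_machineRunsSampler
/-- Statement of `stub_idleWireGuard`. -/
abbrev stub_idleWireGuard : Prop := type_of% PauliFidelitySampling.stub_idleWireGuard
/-- Statement of `stub_fpDeciderWitness`. -/
abbrev stub_fpDeciderWitness : Prop := type_of% PauliFidelitySampling.stub_fpDeciderWitness

end Statement

/-! ## The composition (kernel-checked, sorry-free): S1 + S2 ⇒ Chebyshev counting; + S3, S4, S5 ⇒ crux -/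

section Composition

variable (I : KForrelationInstance) (hk : I.k = 2)

/-- **Chebyshev for the estimator** from S1 (moments `μ = Φ²`, `σ = 1`, `κ = 2n`) and S2 (`L = N`,
`δ = 0.17 N`): the deviating block tuples are at most a third (`3 ≤ 0.0289 N` for `N = 128`).
[cite: AroraBarak2009, Lemma A.12] -/
theorem card_deviates_le_of (h₁ : Statement.stub_pauliFidelityMoments) (h₂ : Statement.stub_chebyshevCoinBlocks)
    (hf : IsDegLeFun 3 (fI I hk)) :
    3 * ((univ.filter fun ω : Fin CubicDequant.N → Fin (2 * I.n) → Bool =>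
        0.17 * CubicDequant.N ≤ |∑ i, Xblk (fI I hk) (gI I hk) (ω i) -
          CubicDequant.N * forrelation (fI I hk) (gI I hk) ^ 2|).card : ℝ) ≤
      2 ^ (2 * I.n * CubicDequant.N) := by
  have hm := h₁ I.n (fI I hk) (gI I hk) hf
  have h := h₂ (2 * I.n) CubicDequant.N (Xblk (fI I hk) (gI I hk)) (forrelation (fI I hk) (gI I hk) ^ 2) 1
    hm.1 hm.2 (0.17 * CubicDequant.N) (by rw [CubicDequant.N]; norm_num)
  have hN : (0 : ℝ) < CubicDequant.N := by rw [CubicDequant.N]; norm_num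
  have key : 3 * (CubicDequant.N : ℝ) ≤ (0.17 * CubicDequant.N) ^ 2 := by nlinarith [N_large]
  set c := ((univ.filter fun ω : Fin CubicDequant.N → Fin (2 * I.n) → Bool =>
        0.17 * CubicDequant.N ≤ |∑ i, Xblk (fI I hk) (gI I hk) (ω i) -
          CubicDequant.N * forrelation (fI I hk) (gI I hk) ^ 2|).card : ℝ)
  have hc : 0 ≤ c := Nat.cast_nonneg _
  have hp : (0 : ℝ) ≤ 2 ^ (2 * I.n * CubicDequant.N) := by positivity
  nlinarith [h, key, mul_nonneg hc hp]

/-- **Yes side** from S1+S2: `Φ ≥ 3/5` ⇒ at least `2/3` of the block tuples are good (a tuple that is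
not good deviates from `N Φ² ≥ 0.36 N` by more than `0.17 N`). [cite: AaronsonAmbainis2018, §1.1.3] -/
theorem good_yes_of (h₁ : Statement.stub_pauliFidelityMoments) (h₂ : Statement.stub_chebyshevCoinBlocks)
    (hf : IsDegLeFun 3 (fI I hk)) (hΦ : 3 / 5 ≤ forrelation (fI I hk) (gI I hk)) :
    2 * (2 : ℝ) ^ (2 * I.n * CubicDequant.N) ≤
      3 * ((univ.filter fun ω : Fin CubicDequant.N → Fin (2 * I.n) → Bool => Good I hk ω).card : ℝ) := by
  have hdev := card_deviates_le_of I hk h₁ h₂ hf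
  set μ := forrelation (fI I hk) (gI I hk) ^ 2
  have hμ : 0.36 ≤ μ := by nlinarith
  have hsub : (univ.filter fun ω : Fin CubicDequant.N → Fin (2 * I.n) → Bool => ¬ Good I hk ω) ⊆
      univ.filter fun ω => 0.17 * CubicDequant.N ≤ |∑ i, Xblk (fI I hk) (gI I hk) (ω i) - CubicDequant.N * μ| := by
    intro ω hω
    rw [mem_filter] at hω ⊢
    refine ⟨mem_univ _, ?_⟩
    have hng : ¬ (9 * (CubicDequant.N : ℝ) ≤ 50 * ∑ r, Xblk (fI I hk) (gI I hk) (ω r)) := hω.2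
    push Not at hng
    have hN : (0 : ℝ) < CubicDequant.N := by rw [CubicDequant.N]; norm_num
    rw [abs_sub_comm, abs_of_nonneg (by nlinarith)]
    nlinarith
  have hcard := card_le_card hsub
  have htot := Finset.card_filter_add_card_filter_not
    (s := (univ : Finset (Fin CubicDequant.N → Fin (2 * I.n) → Bool))) (fun ω => Good I hk ω)
  rw [card_univ, Fintype.card_fun, Fintype.card_fin, Fintype.card_fun, Fintype.card_bool, Fintype.card_fin] at htot
  have htot' : (((univ.filter fun ω : Fin CubicDequant.N → Fin (2 * I.n) → Bool => Good I hk ω).card : ℝ) +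
      ((univ.filter fun ω : Fin CubicDequant.N → Fin (2 * I.n) → Bool => ¬ Good I hk ω).card : ℝ)) =
        2 ^ (2 * I.n * CubicDequant.N) := by
    rw [← pow_mul] at htot; exact_mod_cast htot
  have hcard' : ((univ.filter fun ω : Fin CubicDequant.N → Fin (2 * I.n) → Bool => ¬ Good I hk ω).card : ℝ) ≤
      ((univ.filter fun ω : Fin CubicDequant.N → Fin (2 * I.n) → Bool =>
        0.17 * CubicDequant.N ≤ |∑ i, Xblk (fI I hk) (gI I hk) (ω i) - CubicDequant.N * μ|).card : ℝ) := by
    exact_mod_cast hcard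
  have hB : 3 * ((univ.filter fun ω : Fin CubicDequant.N → Fin (2 * I.n) → Bool => ¬ Good I hk ω).card : ℝ) ≤
      2 ^ (2 * I.n * CubicDequant.N) :=
    le_trans (mul_le_mul_of_nonneg_left hcard' (by norm_num)) hdev
  linarith [htot', hB]

/-- **No side** from S1+S2: `|Φ| ≤ 1/100` ⇒ at least `2/3` of the block tuples are not good.
[cite: AaronsonAmbainis2018, §1.1.3] -/
theorem bad_no_of (h₁ : Statement.stub_pauliFidelityMoments) (h₂ : Statement.stub_chebyshevCoinBlocks)
    (hf : IsDegLeFun 3 (fI I hk)) (hΦ : |forrelation (fI I hk) (gI I hk)| ≤ 1 / 100) :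
    2 * (2 : ℝ) ^ (2 * I.n * CubicDequant.N) ≤
      3 * ((univ.filter fun ω : Fin CubicDequant.N → Fin (2 * I.n) → Bool => ¬ Good I hk ω).card : ℝ) := by
  have hdev := card_deviates_le_of I hk h₁ h₂ hf
  set μ := forrelation (fI I hk) (gI I hk) ^ 2
  have hμ : μ ≤ 0.0001 := by
    have := sq_abs (forrelation (fI I hk) (gI I hk))
    nlinarith [abs_nonneg (forrelation (fI I hk) (gI I hk))]
  have hμ0 : 0 ≤ μ := sq_nonneg _
  have hsub : (univ.filter fun ω : Fin CubicDequant.N → Fin (2 * I.n) → Bool => Good I hk ω) ⊆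
      univ.filter fun ω => 0.17 * CubicDequant.N ≤ |∑ i, Xblk (fI I hk) (gI I hk) (ω i) - CubicDequant.N * μ| := by
    intro ω hω
    rw [mem_filter] at hω ⊢
    refine ⟨mem_univ _, ?_⟩
    have hg : 9 * (CubicDequant.N : ℝ) ≤ 50 * ∑ r, Xblk (fI I hk) (gI I hk) (ω r) := hω.2
    have hN : (0 : ℝ) < CubicDequant.N := by rw [CubicDequant.N]; norm_num
    rw [abs_of_nonneg (by nlinarith)]
    nlinarith
  have hcard := card_le_card hsub
  have htot := Finset.card_filter_add_card_filter_not
    (s := (univ : Finset (Fin CubicDequant.N → Fin (2 * I.n) → Bool))) (fun ω => Good I hk ω)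
  rw [card_univ, Fintype.card_fun, Fintype.card_fin, Fintype.card_fun, Fintype.card_bool, Fintype.card_fin] at htot
  have htot' : (((univ.filter fun ω : Fin CubicDequant.N → Fin (2 * I.n) → Bool => Good I hk ω).card : ℝ) +
      ((univ.filter fun ω : Fin CubicDequant.N → Fin (2 * I.n) → Bool => ¬ Good I hk ω).card : ℝ)) =
        2 ^ (2 * I.n * CubicDequant.N) := by
    rw [← pow_mul] at htot; exact_mod_cast htot
  have hcard' : ((univ.filter fun ω : Fin CubicDequant.N → Fin (2 * I.n) → Bool => Good I hk ω).card : ℝ) ≤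
      ((univ.filter fun ω : Fin CubicDequant.N → Fin (2 * I.n) → Bool =>
        0.17 * CubicDequant.N ≤ |∑ i, Xblk (fI I hk) (gI I hk) (ω i) - CubicDequant.N * μ|).card : ℝ) := by
    exact_mod_cast hcard
  have hG : 3 * ((univ.filter fun ω : Fin CubicDequant.N → Fin (2 * I.n) → Bool => Good I hk ω).card : ℝ) ≤
      2 ^ (2 * I.n * CubicDequant.N) :=
    le_trans (mul_le_mul_of_nonneg_left hcard' (by norm_num)) hdev
  linarith [htot', hG]

end Composition

/-- **The crux along this line**: S1–S5 ⇒ `CubicForrelationInPrBPP` (sorry-free composition; the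
five hypotheses are the statements of the five registered stubs, by name). Yes side: S4 gives the
guard, S3 turns the acceptance probability into the fraction of good block tuples, S1+S2 bound it
below by `2/3`; no side: under the guard likewise with the bad tuples, and when the guard fails the
machine rejects every coin string; S5 turns the two bounds into membership.
[cite: AaronsonAmbainis2018, §1.1.3 and §6 Thm 26] -/
theorem CubicForrelationInPrBPP_of (h₁ : Statement.stub_pauliFidelityMoments)
    (h₂ : Statement.stub_chebyshevCoinBlocks) (h₃ : Statement.stub_machineRunsSampler)
    (h₄ : Statement.stub_idleWireGuard) (h₅ : Statement.stub_fpDeciderWitness) :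
    Summit.QuantumAdvantage.QuantumAdvantage.Theses.CubicForrelation.CubicForrelationInPrBPP := by
  show cubicKForrelationProblem 2 ∈ PromiseBPP'
  refine h₅ (cubicKForrelationProblem 2) coinPoly (fun I hI => ?_) (fun I hI => ?_)
    (cubic_yes_codes 2) (cubic_no_codes 2)
  · obtain ⟨I', hII', hyes, hk, hdeg⟩ := of_mem_yes hI
    obtain rfl : I' = I := KForrelationInstance.encode_injective hII'
    have hf : IsDegLeFun 3 (fI I' hk) := hdeg _
    have hg : IsDegLeFun 3 (gI I' hk) := hdeg _
    have hn : I'.n ≤ I'.encode.length + 1 := h₄ I' hk hyes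
    rw [h₃ I' hk hf hg hn true, le_div_iff₀ (by positivity)]
    have hΦ : 3 / 5 ≤ forrelation (fI I' hk) (gI I' hk) := by
      rw [← value_eq_forrelation_fg I' hk]; exact hyes.2
    have := good_yes_of I' hk h₁ h₂ hf hΦ
    rw [mul_comm CubicDequant.N (2 * I'.n)]
    have e : (univ.filter fun ω : Fin CubicDequant.N → Fin (2 * I'.n) → Bool => decide (Good I' hk ω) = true) =
        univ.filter fun ω => Good I' hk ω := by ext ω; simp
    rw [e]
    linarith
  · obtain ⟨I', hII', hno, hk, hdeg⟩ := of_mem_no hI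
    obtain rfl : I' = I := KForrelationInstance.encode_injective hII'
    have hf : IsDegLeFun 3 (fI I' hk) := hdeg _
    have hg : IsDegLeFun 3 (gI I' hk) := hdeg _
    by_cases hn : I'.n ≤ I'.encode.length + 1
    · rw [h₃ I' hk hf hg hn false, le_div_iff₀ (by positivity)]
      have hΦ : |forrelation (fI I' hk) (gI I' hk)| ≤ 1 / 100 := by
        rw [← value_eq_forrelation_fg I' hk]; exact hno.2
      have := bad_no_of I' hk h₁ h₂ hf hΦ
      rw [mul_comm CubicDequant.N (2 * I'.n)]
      have e : (univ.filter fun ω : Fin CubicDequant.N → Fin (2 * I'.n) → Bool => decide (Good I' hk ω) = false) =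
          univ.filter fun ω => ¬ Good I' hk ω := by ext ω; simp
      rw [e]
      linarith
    · -- guard fails: the machine rejects every coin string
      have hall : ∀ y : List Bool, accept (instOf I') I'.encode.length y = false := by
        intro y
        rw [accept, show (instOf I').1 = I'.n from rfl]
        simp [hn]
      have : uniformProb (coinPoly.eval I'.encode.length)
          {y | accept (instOf I') I'.encode.length y = false} = 1 := by
        rw [show {y : List Bool | accept (instOf I') I'.encode.length y = false} = Set.univ from
          Set.eq_univ_of_forall hall]
        exact uniformProb_univ _
      rw [this]; norm_num

/-- The crux MODULO the five registered stubs (references every `stub_*`, so the skeleton audit shows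
exactly which sorries `CubicForrelationInPrBPP` still depends on along this line; with the five
`closes by:` terms substituted this is a complete proof — cf. the tree's
`CubicDequant.cubicKForrelationProblem_two_mem_PromiseBPP'`). -/
theorem CubicForrelationInPrBPP_proof :
    Summit.QuantumAdvantage.QuantumAdvantage.Theses.CubicForrelation.CubicForrelationInPrBPP :=
  CubicForrelationInPrBPP_of stub_pauliFidelityMoments stub_chebyshevCoinBlocks stub_machineRunsSampler
    stub_idleWireGuard stub_fpDeciderWitness

end Summit.QuantumAdvantage.QuantumAdvantage.Cruxes.CubicForrelationInPrBPP.PauliFidelitySampling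

end
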